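import Summits.AnomalousDissipation.AnomalousDissipation.Theses.TwoAndHalfD
import Summits.AnomalousDissipation.AnomalousDissipation.Theorems.TwohalfdNeg.Negative.FreeDecay
import Literature.Analysis.FluidPDE.TwoHalfNavierStokes
import Literature.Analysis.FunctionSpaces.TorusAxisAverageCalculus
import Literature.Analysis.FluidPDE.LongTimeAverageNonneg

/-!
# The registered stub `stub_reduction` of crux `TwoAndHalfD.TwohalfdNeg` (stmt-AnomalousDissipation-0211),
# line `log-kantorovich-enstrophy-transfer`, is FALSE as stated: the slice `t = 0` is free

Negative knowledge for the `x₃`-invariant reduction S1.  The accepted `Torus.IsLerayHopfOn T ν f u₀ u`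
constrains the slice `u 0` only through `MemLp (u 0) 2` and the energy inequality at `t = 0`,
`½‖u 0‖² ≤ ½‖u₀‖²` (the weak identity, the `L^∞L²`/`L²H¹` clauses and the a.e.-`s` energy inequality live
on `(0, T)`, weak/strong continuity are limits along `𝓝[>] 0`); hence the slice of a Leray–Hopf solution at
`t = 0` may be replaced by ANY `L²` field of smaller energy (`isLerayHopfOn_update_zero`).  The registered
conclusion of `stub_reduction` asks for the pointwise split `u j t = twoHalf (v j t) (θ j t)` at EVERY `t`,
which pins `v j 0` to the planar section of `u j 0`, and simultaneously for
`IsGlobalLerayHopf (ν j) (fun _ => g) (v₀ j) (v j)`, whose datum `v₀ j` is pinned (a.e.) by the strong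
initial trace of the planar sections at `t → 0⁺`; replacing the slice `u j 0` of a genuine `x₃`-invariant
solution by a purely planar field of admissible energy makes `½‖v j 0‖² ≤ ½‖v₀ j‖²` fail.

Witness (`stub_reduction_false`): `f = 0`, `ν_j = 1`, the free decay `u(t) = (0,0,e^{-4π²t}cos 2πx₀)`
(`Negative.isGlobalLerayHopf_decay 0`, datum `shear 0 1`, energy `¼`) with its slice at `t = 0` replaced by
the constant planar field `(½, 0, 0)` (energy `⅛ ≤ ¼`): every admissible planar family has `v j t = 0` for
`t > 0`, so `‖v₀ j‖₂ = 0` by the strong trace, while `v j 0 = (½, 0)` has energy `⅛ > 0`.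
Repair (for the lead): ask the pointwise split only for `t ≠ 0` (the composition `TwohalfdNeg_of` discards
it anyway), e.g. `(∀ j (t : ℝ), t ≠ 0 → u j t = Torus.twoHalf (v j t) (θ j t))`.
-/

set_option linter.dupNamespace false

noncomputable section

namespace Summit.AnomalousDissipation.AnomalousDissipation.Theorems.TwohalfdNeg.Negative.ReductionSliceZero

open MeasureTheory Set Filter Topology UnitAddTorus Function
open scoped ENNReal NNReal InnerProductSpace
open Literature.Analysis.FunctionSpaces Literature.Analysis.FunctionSpaces.Torus
open Literature.Analysis.FluidPDE Literature.Analysis.FluidPDE.Torus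
open Summit.AnomalousDissipation.AnomalousDissipation.Theorems.TwohalfdNeg.Negative

/-! ## 1. The slice `t = 0` of a Leray–Hopf solution is free -/

section SliceZero

variable {d : Type*} [Fintype d] [DecidableEq d] {T ν : ℝ} {f u : ℝ → UnitAddTorus d → EuclideanSpace ℝ d}
  {u₀ w : UnitAddTorus d → EuclideanSpace ℝ d}

omit [Fintype d] [DecidableEq d] in
/-- Replacing the slice at `t = 0` does not change the slices at positive times. [folklore] -/
theorem update_zero_of_pos {t : ℝ} (ht : 0 < t) : Function.update u 0 w t = u t :=
  Function.update_of_ne ht.ne' _ _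

/-- **The slice `t = 0` of a Leray–Hopf solution on the torus is free**: replacing `u 0` by any `w ∈ L²`
with `½‖w‖² ≤ ½‖u₀‖²` gives again a Leray–Hopf solution with the same force and datum (every clause of
`Torus.IsLerayHopfOn` sees `u` only on `(0, T]`, along `𝓝[>] 0`, or at `t = 0` through
`MemLp (u 0) 2` and `kineticEnergy (u 0) ≤ kineticEnergy u₀`). [folklore] -/
theorem isLerayHopfOn_update_zero (hu : IsLerayHopfOn T ν f u₀ u) (hw : MemLp w 2 volume)
    (hE : kineticEnergy w ≤ kineticEnergy u₀) : IsLerayHopfOn T ν f u₀ (Function.update u 0 w) := by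
  have hIoo : ∀ t ∈ Ioo (0 : ℝ) T, Function.update u 0 w t = u t := fun t ht => update_zero_of_pos ht.1
  refine ⟨⟨?_, ?_, ?_, fun ψ hψ hdiv => ?_⟩, ?_, fun t ht => ?_, ⟨?_, ?_⟩, fun t ht => ?_, ?_, fun z hz => ⟨?_, ?_⟩, ?_⟩
  · -- measurability on the slab
    refine hu.weak.1.congr ?_
    have hS : MeasurableSet (Ioo (0 : ℝ) T ×ˢ (univ : Set (EuclideanSpace ℝ d))) := measurableSet_Ioo.prod MeasurableSet.univ
    filter_upwards [ae_restrict_mem hS] with p hp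
    show u p.1 (proj p.2) = Function.update u 0 w p.1 (proj p.2)
    rw [hIoo p.1 hp.1]
  · rw [setLIntegral_congr_fun measurableSet_Ioo (fun t ht => by rw [hIoo t ht])]
    exact hu.weak.2.1
  · filter_upwards [hu.weak.2.2.1, ae_restrict_mem measurableSet_Ioo] with t ht htI
    rwa [hIoo t htI]
  · rw [setIntegral_congr_fun measurableSet_Ioo (fun t ht => by rw [hIoo t ht])]
    exact hu.weak.2.2.2 ψ hψ hdiv
  · obtain ⟨C, hC⟩ := hu.energy_bound
    refine ⟨C, ?_⟩
    filter_upwards [hC, ae_restrict_mem measurableSet_Ioo] with t ht htI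
    rwa [hIoo t htI]
  · rcases eq_or_lt_of_le ht.1 with h0 | h0
    · subst h0
      rwa [Function.update_self]
    · rw [update_zero_of_pos h0]
      exact hu.memLp t ht
  · filter_upwards [hu.memL2Sobolev.1, ae_restrict_mem measurableSet_Ioo] with t ht htI
    simpa only [hIoo t htI] using ht
  · have h := hu.memL2Sobolev.2
    unfold eL2SobolevNorm at h ⊢
    have hc : ∫⁻ t in Ioo 0 T, eSobolevNorm 1 (EuclideanSpace.complexify ∘ Function.update u 0 w t) ^ 2 =
        ∫⁻ t in Ioo 0 T, eSobolevNorm 1 (EuclideanSpace.complexify ∘ u t) ^ 2 :=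
      setLIntegral_congr_fun measurableSet_Ioo (fun t ht => by rw [hIoo t ht])
    rw [hc]
    exact h
  · -- energy inequality from `0`
    rcases eq_or_lt_of_le ht.1 with h0 | h0
    · subst h0
      simp only [Function.update_self, Ioo_self, Measure.restrict_empty, lintegral_zero_measure,
        ENNReal.toReal_zero, mul_zero, add_zero, intervalIntegral.integral_same]
      exact hE
    · have h := hu.energy_ineq_zero t ht
      rw [update_zero_of_pos h0, setLIntegral_congr_fun measurableSet_Ioo (fun τ hτ => by rw [update_zero_of_pos hτ.1]),
        intervalIntegral.integral_of_le ht.1,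
        setIntegral_congr_fun measurableSet_Ioc (fun τ hτ => by rw [update_zero_of_pos hτ.1])]
      rwa [intervalIntegral.integral_of_le ht.1] at h
  · -- energy inequality from a.e. `s`
    filter_upwards [hu.energy_ineq_ae, ae_restrict_mem measurableSet_Ioo] with s hs hsI t hst
    have h := hs t hst
    have ht0 : 0 < t := hsI.1.trans_le hst.1
    rw [update_zero_of_pos ht0, update_zero_of_pos hsI.1,
      setLIntegral_congr_fun measurableSet_Ioo (fun τ hτ => by rw [update_zero_of_pos (hsI.1.trans hτ.1)]),
      intervalIntegral.integral_of_le hst.1,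
      setIntegral_congr_fun measurableSet_Ioc (fun τ hτ => by rw [update_zero_of_pos (hsI.1.trans hτ.1)])]
    rwa [intervalIntegral.integral_of_le hst.1] at h
  · exact (hu.weak_continuous z hz).1.congr fun t ht => by simp only [update_zero_of_pos ht.1]
  · refine (hu.weak_continuous z hz).2.congr' ?_
    filter_upwards [self_mem_nhdsWithin] with t ht
    simp only [update_zero_of_pos (show (0 : ℝ) < t from ht)]
  · refine hu.strong_initial.congr' ?_
    filter_upwards [self_mem_nhdsWithin] with t ht
    simp only [update_zero_of_pos (show (0 : ℝ) < t from ht)]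

/-- The global form: the slice `t = 0` of a global Leray–Hopf solution is free. [folklore] -/
theorem isGlobalLerayHopf_update_zero (hu : IsGlobalLerayHopf ν f u₀ u) (hw : MemLp w 2 volume)
    (hE : kineticEnergy w ≤ kineticEnergy u₀) : IsGlobalLerayHopf ν f u₀ (Function.update u 0 w) :=
  fun T hT => isLerayHopfOn_update_zero (hu T hT) hw hE

end SliceZero

/-! ## 2. The witness and the refutation -/

section Refutation

/-- `twoHalf` is injective in the planar datum. [folklore] -/
theorem twoHalf_left_injective {V V' : UnitAddTorus (Fin 2) → EuclideanSpace ℝ (Fin 2)}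
    {R R' : UnitAddTorus (Fin 2) → ℝ} (h : twoHalf V R = twoHalf V' R') : V = V' := by
  funext y
  have h1 := congrArg planarProjE (congrFun h (planarSect y))
  rw [twoHalf, twoHalf, planarProjE_planarEmbed, planarProjE_planarEmbed, planarProj_planarSect] at h1
  exact h1

/-- The planar unit datum `e = (½, 0)`. [folklore] -/
theorem norm_sq_single_half : ‖(EuclideanSpace.single (0 : Fin 2) (1 / 2 : ℝ))‖ ^ 2 = 1 / 4 := by
  rw [EuclideanSpace.norm_sq_eq, Fin.sum_univ_two]
  simp
  norm_num

/-- The kinetic energy of a constant planar field is `½‖e‖²`. [folklore] -/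
theorem kineticEnergy_const (e : EuclideanSpace ℝ (Fin 2)) :
    kineticEnergy (fun _ : UnitAddTorus (Fin 2) => e) = 2⁻¹ * ‖e‖ ^ 2 := by
  unfold kineticEnergy
  rw [integral_const, probReal_univ, one_smul]

/-- The kinetic energy of the lifted constant planar field `(e, 0) ∘ π` is `½‖e‖²`. [folklore] -/
theorem kineticEnergy_twoHalf_const (e : EuclideanSpace ℝ (Fin 2)) :
    kineticEnergy (twoHalf (fun _ : UnitAddTorus (Fin 2) => e) 0) = 2⁻¹ * ‖e‖ ^ 2 := by
  unfold kineticEnergy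
  rw [integral_norm_sq_twoHalf continuous_const continuous_zero, integral_const, probReal_univ, one_smul]
  simp

/-- A field with vanishing `L²` seminorm has zero kinetic energy (junk values included: a
non-integrable `‖v‖²` has Bochner integral `0`). [folklore] -/
theorem kineticEnergy_eq_zero_of_eLpNorm_eq_zero {v : UnitAddTorus (Fin 2) → EuclideanSpace ℝ (Fin 2)}
    (h : eLpNorm v 2 volume = 0) : kineticEnergy v = 0 := by
  unfold kineticEnergy
  suffices hint : ∫ x, ‖v x‖ ^ 2 = 0 by rw [hint, mul_zero]
  have hl : ∫⁻ x, ‖v x‖ₑ ^ (2 : ℝ) = 0 := by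
    rw [eLpNorm_eq_lintegral_rpow_enorm_toReal two_ne_zero ENNReal.ofNat_ne_top, ENNReal.toReal_ofNat] at h
    rcases ENNReal.rpow_eq_zero_iff.1 h with ⟨h1, -⟩ | ⟨-, h2⟩
    · exact h1
    · norm_num at h2
  by_cases hi : Integrable (fun x => ‖v x‖ ^ 2) volume
  · rw [integral_eq_lintegral_of_nonneg_ae (ae_of_all _ fun x => sq_nonneg _) hi.aestronglyMeasurable]
    have he : ∀ x, ENNReal.ofReal (‖v x‖ ^ 2) = ‖v x‖ₑ ^ (2 : ℝ) := fun x => by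
      rw [← ofReal_norm, ENNReal.ofReal_rpow_of_nonneg (norm_nonneg _) (by norm_num), Real.rpow_two]
    simp_rw [he]
    rw [hl, ENNReal.toReal_zero]
  · exact integral_undef hi

/-- **`stub_reduction` is FALSE as registered** (statement copied verbatim from
`Cruxes/TwohalfdNeg/Lines/log-kantorovich-enstrophy-transfer.lean`; see the module docstring for the
witness and the one-token repair). [folklore] -/
theorem stub_reduction_false : ¬ (∀ f : UnitAddTorus (Fin 3) → EuclideanSpace ℝ (Fin 3),
      (∀ (s : UnitAddCircle) (x : UnitAddTorus (Fin 3)), f (x + Pi.single (2 : Fin 3) s) = f x) →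
      Torus.IsSmooth f → Torus.IsDivFree f → Torus.HasZeroMean f →
      ∀ (ν : ℕ → ℝ) (u₀ : ℕ → UnitAddTorus (Fin 3) → EuclideanSpace ℝ (Fin 3))
        (u : ℕ → ℝ → UnitAddTorus (Fin 3) → EuclideanSpace ℝ (Fin 3)),
        (∀ j, 0 < ν j) →
        (∀ j, Torus.IsGlobalLerayHopf (ν j) (fun _ => f) (u₀ j) (u j)) →
        (∀ j (t : ℝ) (s : UnitAddCircle) (x : UnitAddTorus (Fin 3)),
          u j t (x + Pi.single (2 : Fin 3) s) = u j t x) →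
        (∃ E : ℝ, ∀ j, meanEnergy (u j) ≤ E) →
        ∃ (g : UnitAddTorus (Fin 2) → EuclideanSpace ℝ (Fin 2)) (h : UnitAddTorus (Fin 2) → ℝ)
          (v₀ : ℕ → UnitAddTorus (Fin 2) → EuclideanSpace ℝ (Fin 2))
          (v : ℕ → ℝ → UnitAddTorus (Fin 2) → EuclideanSpace ℝ (Fin 2))
          (θ₀ : ℕ → UnitAddTorus (Fin 2) → ℝ) (θ : ℕ → ℝ → UnitAddTorus (Fin 2) → ℝ),
          Torus.IsSmooth g ∧ Torus.IsDivFree g ∧ Torus.HasZeroMean g ∧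
          Torus.IsSmooth h ∧ Torus.HasZeroMean h ∧
          f = Torus.twoHalf g h ∧ (∀ j (t : ℝ), u j t = Torus.twoHalf (v j t) (θ j t)) ∧
          (∀ j, Torus.IsGlobalLerayHopf (ν j) (fun _ => g) (v₀ j) (v j)) ∧
          (∀ j, MemLp (θ₀ j) 2 volume) ∧
          (∀ j, Torus.IsWeakScalarTransportForced (ν j) (v j) (fun _ => h) (θ₀ j) (θ j)) ∧
          (∃ E : ℝ, ∀ j, meanEnergy (v j) ≤ E) ∧
          (∃ E : ℝ, ∀ j, longTimeAvgSup (fun t => Torus.scalarL2Sq (θ j t)) ≤ E) ∧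
          (∀ j, meanDissipation (ν j) (u j) ≤
            meanDissipation (ν j) (v j) +
              longTimeAvgSup (fun t => ν j * (Torus.eScalarGradNormSq (θ j t)).toReal))) := by
  intro H
  -- the witness: free decay with the slice `t = 0` replaced by the planar constant `(½, 0, 0)`
  set e : EuclideanSpace ℝ (Fin 2) := EuclideanSpace.single (0 : Fin 2) (1 / 2 : ℝ) with he
  set w : UnitAddTorus (Fin 3) → EuclideanSpace ℝ (Fin 3) := twoHalf (fun _ => e) 0 with hw_def
  set U : ℝ → UnitAddTorus (Fin 3) → EuclideanSpace ℝ (Fin 3) := Function.update (decayState 0 1) 0 w with hU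
  have hw2 : MemLp w 2 volume := ((isSmooth_const (d := Fin 2) e).twoHalf (isSmooth_const (d := Fin 2) (0 : ℝ))).memLp 2
  have hEw : kineticEnergy w = 1 / 8 := by
    rw [hw_def, kineticEnergy_twoHalf_const, norm_sq_single_half]; norm_num
  have hE0 : kineticEnergy (shear 0 1) = 1 / 4 := by
    unfold kineticEnergy; rw [integral_norm_sq_shear]; norm_num
  have hLH : IsGlobalLerayHopf 1 (fun _ => (0 : UnitAddTorus (Fin 3) → EuclideanSpace ℝ (Fin 3))) (shear 0 1) U :=
    isGlobalLerayHopf_update_zero (isGlobalLerayHopf_decay 0 (by norm_num) 1) hw2 (by rw [hEw, hE0]; norm_num)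
  have hsm : IsSmooth (0 : UnitAddTorus (Fin 3) → EuclideanSpace ℝ (Fin 3)) := isSmooth_const (0 : EuclideanSpace ℝ (Fin 3))
  have hdf : IsDivFree (0 : UnitAddTorus (Fin 3) → EuclideanSpace ℝ (Fin 3)) := fun x => by
    simp [Torus.divergence, Torus.partialDeriv, Torus.lineDeriv]
  have hzm : HasZeroMean (0 : UnitAddTorus (Fin 3) → EuclideanSpace ℝ (Fin 3)) := by simp [HasZeroMean]
  have hinv : ∀ (t : ℝ) (s : UnitAddCircle) (x : UnitAddTorus (Fin 3)), U t (x + Pi.single (2 : Fin 3) s) = U t x := by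
    intro t s x
    by_cases ht : t = 0
    · subst ht
      simp only [hU, Function.update_self, hw_def]
      rw [twoHalf_eq_comp, Function.comp_apply, Function.comp_apply]
      exact comp_planarProj_add_single (fun y => planarEmbed ((fun _ : UnitAddTorus (Fin 2) => e) y, (0 : UnitAddTorus (Fin 2) → ℝ) y)) s x
    · simp only [hU, Function.update_of_ne ht, decayState_eq]
      exact shear_add_single 0 _ s x
  obtain ⟨g, h, v₀, v, θ₀, θ, -, -, -, -, -, -, hsplit, hvLH, -⟩ :=
    H 0 (fun _ _ => rfl) hsm hdf hzm (fun _ => 1) (fun _ => shear 0 1) (fun _ => U) (fun _ => one_pos)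
      (fun _ => hLH) (fun _ => hinv) ⟨meanEnergy U, fun _ => le_rfl⟩
  -- the planar family is pinned: `v 0 0 = e`, `v 0 t = 0` for `t > 0`
  have hv0 : v 0 0 = fun _ => e := by
    have h1 := hsplit 0 0
    rw [show U 0 = w by simp only [hU, Function.update_self], hw_def] at h1
    exact (twoHalf_left_injective h1).symm
  have hvt : ∀ t : ℝ, 0 < t → v 0 t = 0 := fun t ht => by
    have h1 := hsplit 0 t
    rw [show U t = decayState 0 1 t from update_zero_of_pos ht, decayState] at h1
    exact (twoHalf_left_injective h1).symm
  have hL : IsLerayHopfOn 1 1 (fun _ => g) (v₀ 0) (v 0) := hvLH 0 1 one_pos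
  -- the strong trace forces `‖v₀ 0‖₂ = 0`
  have htr : Tendsto (fun _ : ℝ => eLpNorm (v₀ 0) 2 volume) (𝓝[>] (0 : ℝ)) (𝓝 0) := by
    refine hL.strong_initial.congr' ?_
    filter_upwards [self_mem_nhdsWithin] with t ht
    rw [hvt t ht, zero_sub, eLpNorm_neg]
  have hnorm : eLpNorm (v₀ 0) 2 volume = 0 := tendsto_nhds_unique tendsto_const_nhds htr
  have hkin : kineticEnergy (v₀ 0) = 0 := kineticEnergy_eq_zero_of_eLpNorm_eq_zero hnorm
  -- the energy inequality of the planar family at `t = 0` fails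
  have hineq := hL.energy_ineq_zero 0 ⟨le_rfl, zero_le_one⟩
  simp only [Ioo_self, Measure.restrict_empty, lintegral_zero_measure, ENNReal.toReal_zero, mul_zero,
    add_zero, intervalIntegral.integral_same, hkin, hv0, kineticEnergy_const] at hineq
  rw [norm_sq_single_half] at hineq
  norm_num at hineq

end Refutation

end Summit.AnomalousDissipation.AnomalousDissipation.Theorems.TwohalfdNeg.Negative.ReductionSliceZero

end
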